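import Literature.AnabelianGeometry.SemiGraphs.TemperedDeltaCompletion
import Literature.AnabelianGeometry.SemiGraphs.TemperedDeltaTower
import Literature.AnabelianGeometry.SemiGraphs.TemperedAnabelianLem63iiiProofs
import Literature.AnabelianGeometry.SemiGraphs.TemperedOrigin
import Literature.AnabelianGeometry.SemiGraphs.TemperedDecompositionCompact
import HarnessLib

/-!
# [SemiAnbd] Lemma 6.1 (ii), Lemma 6.3 (iii) for `F = Δ^temp_X`, from the tower structure of `Π^temp`

Mochizuki, *Semi-graphs of anabelioids*, Publ. RIMS **42** (2006) [SemiAnbd], §6, author's manuscript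
pp. 69–70: Lemma 6.1 (ii) "`N_{Δ_X}(Δ^temp_X) = Δ^temp_X`" (print: [André], Cor. 6.2.2) and Lemma 6.3
(iii) "Suppose that `F₁, F₂ ⊆ F` are subgroups of DOF-type which are dense in `F̂`. Then, for any
`f ∈ F̂` such that `f · F₁ · f⁻¹ = F₂`, it follows that `f ∈ F`", in the case `F = Δ^temp_X`
(Lemma 6.3 (ii) for `Δ^temp_X`, `deltaTempDFGIffDOF_of_virtuallyFreeQuotients`, takes the completion
hypothesis discharged by `isProfiniteCompletion_deltaToHat` directly).
[cite: MochizukiSemiAnbd2006, Lem 6.1(ii) p.69, Lem 6.3(iii) p.70]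

PROOF-ONLY file (abc-iut cell, prover abc-iut-w5-d139; no definitions, no named facts).  The
`Π^temp_{X_K}`-halves of these lemmas are theorems of the tree modulo the structural tower input
`htower₀` of `Π^temp` (abc-iut-w5-d240: `TemperedCurve.piTempNormallyTerminal_of_tower`,
`piTempDenseDOFConjugator_of_tower`, over the generic
inverse-limit engine `IsTempered.normalizer_range_eq_of_tower` / `mem_range_of_conj_eq_of_dense` and
[EtTh] Lem. 2.17 (i) `DiscreteNormalizers.lem217_i`).  The `Δ^temp_X`-halves were recorded as needing
"additionally `IsProfiniteCompletion X.deltaToHat` (not an interface axiom)" and the tower input for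
`Δ^temp_X`.  Both are THEOREMS for tempered, Galois-countable `X`
(`TemperedCurve.isProfiniteCompletion_deltaToHat`, `TemperedDeltaCompletion.lean`;
`TemperedCurve.deltaTemp_tower_of_tower`, `TemperedDeltaTower.lean`), and `Δ^temp_X` is tempered
([SemiAnbd] Ex. 3.10 p. 43 "Note that `Δ` is also tempered"; recorded in the parameter bundle as
`GroupLevelData.isTempered_ker`, transported along `TemperedCurve.ker_augK`).  Hence, for `X` with
parameter bundle `d : X.GroupLevelData` (ruling η′) and the SAME single input `htower₀` for
`Π^temp_{X_K}` as the `Π^temp`-halves and the L2 lane's [EtTh] Lem. 2.17 (ii):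

* `TemperedCurve.deltaTempNormallyTerminal_of_tower` (`d`) / `…_of_isTempered` (`hT`, first countable)
  — Lemma 6.1 (ii) `X.DeltaTempNormallyTerminal`;
* `TemperedCurve.deltaTempDenseDOFConjugator_of_tower` / `…_of_isTempered` — Lemma 6.3 (iii)
  `X.DeltaTempDenseDOFConjugator`;
* `TemperedCurve.profiniteNormalizers_of_tower` — Lemma 6.1 (ii) ∧ (iii) at `X`;
* `TemperedOrigin.profiniteNormalizersHolds_of_tower` / `…_of_isTempered` — the typed fact
  `Ω.ProfiniteNormalizersHolds`
  ([SemiAnbd] Lem. 6.1 (ii)(iii) as printed; the input of Thm. 6.6 `profiniteOuterIsoLiftsHolds_of`)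
  from `GroupLevelData` and the `Π^temp` tower structure of the certified curves alone.

Classical topological group theory; nothing here concerns the disputed parts of inter-universal
Teichmüller theory or takes a side on [IUTchIII] Cor. 3.12; typed ≠ proved.
-/

noncomputable section

namespace Literature.AnabelianGeometry.SemiGraphs

namespace TemperedCurve

open _root_.Topology
open scoped Pointwise

variable {p : ℕ} [Fact p.Prime] (X : TemperedCurve p)

/-- `Δ^temp_X` is tempered ([SemiAnbd] Ex. 3.10 p. 43: "Note that `Δ` is also tempered"): the
parameter bundle records `IsTempered` for `Ker(augK ι) = Ker(aug) = Δ^temp_X` (`TemperedCurve.ker_augK`).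
[cite: MochizukiSemiAnbd2006, Ex 3.10 p.43] -/
theorem isTempered_deltaTemp (d : X.GroupLevelData) : IsTempered X.DeltaTemp := by
  have h := d.isTempered_ker
  rw [X.ker_augK d.galEquiv] at h
  exact h

/-- The range of `deltaToHat : Δ^temp_X → Δ_X` is the image of `Δ^temp_X` in `Π_X`, viewed inside
`Δ_X`. [cite: MochizukiSemiAnbd2006, §6 p.69] -/
theorem range_deltaToHat :
    X.deltaToHat.toMonoidHom.range = (X.DeltaTemp.map X.toHat.toMonoidHom).subgroupOf X.DeltaHat := by
  ext x
  rw [Subgroup.mem_subgroupOf]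
  constructor
  · rintro ⟨g, rfl⟩
    exact ⟨g, g.2, rfl⟩
  · rintro ⟨g, hg, hgx⟩
    exact ⟨⟨g, hg⟩, Subtype.ext hgx⟩

/-- **[SemiAnbd] Lemma 6.1 (ii)** ("`N_{Δ_X}(Δ^temp_X) = Δ^temp_X`", p. 69) — the typed node
`X.DeltaTempNormallyTerminal` — for `X` with `Π^temp_{X_K}` tempered (`IsTempered`) and Galois-countable
(first countable suffices), modulo ONLY the structural tower input `htower₀` for `Π^temp_{X_K}` ([André
2003, §4.5]).  `Δ^temp_X` is tempered (`isTempered_deltaTemp_of_isTempered`), `Δ^temp_X ↪ Δ_X` is a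
profinite completion (`isProfiniteCompletion_deltaToHat_of_isTempered`), the tower passes to `Δ^temp_X`
(`deltaTemp_tower_of_tower_of_isTempered`), and the inverse-limit normaliser argument is w5-d240's
`IsTempered.normalizer_range_eq_of_tower`. [cite: MochizukiSemiAnbd2006, Lem 6.1(ii) p.69] -/
theorem deltaTempNormallyTerminal_of_isTempered (hT : IsTempered X.PiTemp)
    [FirstCountableTopology X.PiTemp]
    (htower₀ : ∀ U ∈ 𝓝 (1 : X.PiTemp), ∃ N : OpenNormalSubgroup X.PiTemp, (N : Set X.PiTemp) ⊆ U ∧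
      ∃ (G : Subgroup (X.PiTemp ⧸ N.toSubgroup)) (_ : IsFreeGroup G), G.Normal ∧ G.FiniteIndex ∧
        Finite (IsFreeGroup.Generators G) ∧ ∃ a ∈ G, ∃ b ∈ G, a * b ≠ b * a) :
    X.DeltaTempNormallyTerminal := by
  have h := (X.isTempered_deltaTemp_of_isTempered hT).normalizer_range_eq_of_tower X.deltaToHat
    (X.isProfiniteCompletion_deltaToHat_of_isTempered hT)
    (X.deltaTemp_tower_of_tower_of_isTempered hT htower₀)
  rw [range_deltaToHat] at h
  exact h

/-- **[SemiAnbd] Lemma 6.1 (ii)** ("`N_{Δ_X}(Δ^temp_X) = Δ^temp_X`", p. 69; print: [André], Cor.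
6.2.2) for a tempered, Galois-countable `X` (`d : X.GroupLevelData`) — the typed node
`X.DeltaTempNormallyTerminal` — modulo ONLY the structural tower input `htower₀` for `Π^temp_{X_K}`:
cofinal open normal `N ⊴ Π^temp` such that `Π^temp/N` contains a non-abelian free normal subgroup of
finite index and finite rank ([André 2003, §4.5]; the hypothesis of [EtTh] Lem. 2.17 (ii)'s and of the
`Π^temp`-half `piTempNormallyTerminal_of_tower`).  The profinite-completion property of
`Δ^temp_X ↪ Δ_X`, the temperedness of `Δ^temp_X` and the tower input for `Δ^temp_X` are THEOREMS
(`isProfiniteCompletion_deltaToHat`, `isTempered_deltaTemp`, `deltaTemp_tower_of_tower`); the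
inverse-limit normaliser argument is w5-d240's `IsTempered.normalizer_range_eq_of_tower` (over
`DiscreteNormalizers.lem217_i`). [cite: MochizukiSemiAnbd2006, Lem 6.1(ii) p.69] -/
theorem deltaTempNormallyTerminal_of_tower (d : X.GroupLevelData)
    (htower₀ : ∀ U ∈ 𝓝 (1 : X.PiTemp), ∃ N : OpenNormalSubgroup X.PiTemp, (N : Set X.PiTemp) ⊆ U ∧
      ∃ (G : Subgroup (X.PiTemp ⧸ N.toSubgroup)) (_ : IsFreeGroup G), G.Normal ∧ G.FiniteIndex ∧
        Finite (IsFreeGroup.Generators G) ∧ ∃ a ∈ G, ∃ b ∈ G, a * b ≠ b * a) :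
    X.DeltaTempNormallyTerminal := by
  have h := (X.isTempered_deltaTemp d).normalizer_range_eq_of_tower X.deltaToHat
    (X.isProfiniteCompletion_deltaToHat d) (X.deltaTemp_tower_of_tower d htower₀)
  rw [range_deltaToHat] at h
  exact h

/-- **[SemiAnbd] Lemma 6.3 (iii) for `F = Δ^temp_X`** (p. 70) — the typed node
`X.DeltaTempDenseDOFConjugator` — for `X` with `Π^temp_{X_K}` tempered and Galois-countable (first
countable suffices), modulo ONLY the tower input for `Π^temp_{X_K}` (w5-d240's generic
`IsTempered.mem_range_of_conj_eq_of_dense` at the profinite completion `Δ^temp_X ↪ Δ_X` and the derived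
tower of `Δ^temp_X`). [cite: MochizukiSemiAnbd2006, Lem 6.3(iii) p.70] -/
theorem deltaTempDenseDOFConjugator_of_isTempered (hT : IsTempered X.PiTemp)
    [FirstCountableTopology X.PiTemp]
    (htower₀ : ∀ U ∈ 𝓝 (1 : X.PiTemp), ∃ N : OpenNormalSubgroup X.PiTemp, (N : Set X.PiTemp) ⊆ U ∧
      ∃ (G : Subgroup (X.PiTemp ⧸ N.toSubgroup)) (_ : IsFreeGroup G), G.Normal ∧ G.FiniteIndex ∧
        Finite (IsFreeGroup.Generators G) ∧ ∃ a ∈ G, ∃ b ∈ G, a * b ≠ b * a) :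
    X.DeltaTempDenseDOFConjugator := fun F₁ F₂ hF₁ hF₂ hd₁ hd₂ f hf =>
  (X.isTempered_deltaTemp_of_isTempered hT).mem_range_of_conj_eq_of_dense X.deltaToHat
    (X.isProfiniteCompletion_deltaToHat_of_isTempered hT)
    (X.deltaTemp_tower_of_tower_of_isTempered hT htower₀) F₁ F₂ hF₁ hF₂ hd₁ hd₂ f hf

/-- **[SemiAnbd] Lemma 6.3 (iii) for `F = Δ^temp_X`** (p. 70) for a tempered, Galois-countable `X` —
the typed node `X.DeltaTempDenseDOFConjugator`: DOF-type subgroups `F₁, F₂ ≤ Δ^temp_X` dense in `Δ_X`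
and `f ∈ Δ_X` with `f·ι(F₁)·f⁻¹ = ι(F₂)` force `f ∈ ι(Δ^temp_X)` — modulo ONLY the tower input for
`Π^temp_{X_K}` (w5-d240's generic `IsTempered.mem_range_of_conj_eq_of_dense` applied to the profinite
completion `Δ^temp_X ↪ Δ_X` and the derived tower of `Δ^temp_X`).
[cite: MochizukiSemiAnbd2006, Lem 6.3(iii) p.70] -/
theorem deltaTempDenseDOFConjugator_of_tower (d : X.GroupLevelData)
    (htower₀ : ∀ U ∈ 𝓝 (1 : X.PiTemp), ∃ N : OpenNormalSubgroup X.PiTemp, (N : Set X.PiTemp) ⊆ U ∧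
      ∃ (G : Subgroup (X.PiTemp ⧸ N.toSubgroup)) (_ : IsFreeGroup G), G.Normal ∧ G.FiniteIndex ∧
        Finite (IsFreeGroup.Generators G) ∧ ∃ a ∈ G, ∃ b ∈ G, a * b ≠ b * a) :
    X.DeltaTempDenseDOFConjugator := fun F₁ F₂ hF₁ hF₂ hd₁ hd₂ f hf =>
  (X.isTempered_deltaTemp d).mem_range_of_conj_eq_of_dense X.deltaToHat
    (X.isProfiniteCompletion_deltaToHat d) (X.deltaTemp_tower_of_tower d htower₀) F₁ F₂ hF₁ hF₂
    hd₁ hd₂ f hf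

/-- **[SemiAnbd] Lemma 6.1 (ii) and (iii) together** — the conjunction
`X.DeltaTempNormallyTerminal ∧ X.PiTempNormallyTerminal` (the `X`-instance of the typed fact
`TemperedOrigin.ProfiniteNormalizersHolds`) for a tempered, Galois-countable `X`, modulo the single
tower input for `Π^temp_{X_K}` ([André 2003, §4.5]; print p. 69: "(ii) is [André], Cor. 6.2.2; (iii)
follows immediately from (ii)"). [cite: MochizukiSemiAnbd2006, Lem 6.1(ii)(iii) p.69] -/
theorem profiniteNormalizers_of_tower (d : X.GroupLevelData)
    (htower₀ : ∀ U ∈ 𝓝 (1 : X.PiTemp), ∃ N : OpenNormalSubgroup X.PiTemp, (N : Set X.PiTemp) ⊆ U ∧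
      ∃ (G : Subgroup (X.PiTemp ⧸ N.toSubgroup)) (_ : IsFreeGroup G), G.Normal ∧ G.FiniteIndex ∧
        Finite (IsFreeGroup.Generators G) ∧ ∃ a ∈ G, ∃ b ∈ G, a * b ≠ b * a) :
    X.DeltaTempNormallyTerminal ∧ X.PiTempNormallyTerminal :=
  ⟨X.deltaTempNormallyTerminal_of_tower d htower₀, X.piTempNormallyTerminal_of_tower d.isTempered htower₀⟩

/-- **[SemiAnbd] Lemma 6.3 (iii), both cases `F = Π^temp_{X_K}` and `F = Δ^temp_X`**, for a tempered,
Galois-countable `X`, modulo the single tower input for `Π^temp_{X_K}`.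
[cite: MochizukiSemiAnbd2006, Lem 6.3(iii) p.70] -/
theorem denseDOFConjugators_of_tower (d : X.GroupLevelData)
    (htower₀ : ∀ U ∈ 𝓝 (1 : X.PiTemp), ∃ N : OpenNormalSubgroup X.PiTemp, (N : Set X.PiTemp) ⊆ U ∧
      ∃ (G : Subgroup (X.PiTemp ⧸ N.toSubgroup)) (_ : IsFreeGroup G), G.Normal ∧ G.FiniteIndex ∧
        Finite (IsFreeGroup.Generators G) ∧ ∃ a ∈ G, ∃ b ∈ G, a * b ≠ b * a) :
    X.PiTempDenseDOFConjugator ∧ X.DeltaTempDenseDOFConjugator :=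
  ⟨X.piTempDenseDOFConjugator_of_tower d.isTempered htower₀,
    X.deltaTempDenseDOFConjugator_of_tower d htower₀⟩

end TemperedCurve

namespace TemperedOrigin

open _root_.Topology

variable {p : ℕ} [Fact p.Prime]

/-- **[SemiAnbd] Lemma 6.1 (ii), (iii) as printed** (the typed fact `Ω.ProfiniteNormalizersHolds`,
input of Thm. 6.6 via `profiniteOuterIsoLiftsHolds_of`): it HOLDS as soon as every certified curve
carries the parameter bundle of ruling η′ (`GroupLevelData`: "`Π^temp` tempered, Galois-countable", …)
and the André tower structure of `Π^temp_{X_K}` (cofinal open normal `N` with quotient containing a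
non-abelian free normal subgroup of finite index and finite rank, [André 2003, §4.5]) — i.e. the fact is
reduced to the structural input its printed proof ([André] Lem. 3.2.1 / Cor. 6.2.2) uses; the same
single input as the L2 lane's [EtTh] Lem. 2.17 (ii). [cite: MochizukiSemiAnbd2006, Lem 6.1(ii)(iii) p.69] -/
theorem profiniteNormalizersHolds_of_tower (Ω : TemperedOrigin p)
    (hstruct : ∀ X : TemperedCurve p, Ω.IsHyperbolicCurveOrigin X →
      Nonempty X.GroupLevelData ∧
      ∀ U ∈ 𝓝 (1 : X.PiTemp), ∃ N : OpenNormalSubgroup X.PiTemp, (N : Set X.PiTemp) ⊆ U ∧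
        ∃ (G : Subgroup (X.PiTemp ⧸ N.toSubgroup)) (_ : IsFreeGroup G), G.Normal ∧ G.FiniteIndex ∧
          Finite (IsFreeGroup.Generators G) ∧ ∃ a ∈ G, ∃ b ∈ G, a * b ≠ b * a) :
    Ω.ProfiniteNormalizersHolds := fun X hX => by
  obtain ⟨⟨d⟩, hPi⟩ := hstruct X hX
  exact X.profiniteNormalizers_of_tower d hPi

/-- **[SemiAnbd] Lemma 6.1 (ii), (iii) as printed** (`Ω.ProfiniteNormalizersHolds`) from the printed
properties of the certified curves' `Π^temp` alone: tempered ([SemiAnbd] Def. 3.1 (i)), Galois-countable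
([IUTchI] Rmk. 2.5.3 (i); first countable suffices), and the André tower structure (`htower₀`, [André
2003, §4.5]) — the hypothesis shape `(IsTempered ∧ htower₀)` of w5-d240's Thm. 6.6 closer
`profiniteOuterIsoLiftsHolds_of_tower`, plus first countability.
[cite: MochizukiSemiAnbd2006, Lem 6.1(ii)(iii) p.69] -/
theorem profiniteNormalizersHolds_of_isTempered (Ω : TemperedOrigin p)
    (hstruct : ∀ X : TemperedCurve p, Ω.IsHyperbolicCurveOrigin X →
      IsTempered X.PiTemp ∧ FirstCountableTopology X.PiTemp ∧
      ∀ U ∈ 𝓝 (1 : X.PiTemp), ∃ N : OpenNormalSubgroup X.PiTemp, (N : Set X.PiTemp) ⊆ U ∧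
        ∃ (G : Subgroup (X.PiTemp ⧸ N.toSubgroup)) (_ : IsFreeGroup G), G.Normal ∧ G.FiniteIndex ∧
          Finite (IsFreeGroup.Generators G) ∧ ∃ a ∈ G, ∃ b ∈ G, a * b ≠ b * a) :
    Ω.ProfiniteNormalizersHolds := fun X hX => by
  obtain ⟨hT, hfc, hPi⟩ := hstruct X hX
  haveI := hfc
  exact ⟨X.deltaTempNormallyTerminal_of_isTempered hT hPi, X.piTempNormallyTerminal_of_tower hT hPi⟩

end TemperedOrigin

end Literature.AnabelianGeometry.SemiGraphs

end
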